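import Summits.CriticalPhenomena.PercolationContinuityZ3.Theorems.PercNearOneGluingNoHeavyLowerTailAntitheticApexConeInvarianceTwo
import Summits.CriticalPhenomena.PercolationContinuityZ3.Theorems.PercNearOneGluingNoHeavyLowerTailAntitheticConesHangingSinks
import HarnessLib

/-!
# `NoHeavyLowerTail` (stmt-CriticalPhenomena-4575) — antithetic cluster pairs: THEOREM K — BIC for EVERY avoidance set `R` on CONES WITH
# CLIQUE-APEXES, and the antithetic BHK inequality with sinks on that class (prim-hp-2 gen 37; MEMO-gen36 §4f CONJECTURE K, MEMO-gen37 §1–§3)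

Support file (`--supports stmt-CriticalPhenomena-4575`, hull-port prover `prim-hp-2`, gen 37).  No definitions, no named facts, no sorries;
standard axioms.

SETTING (MEMO-gen29 §3, MEMO-gen31 §1).  Colourings `ω ⊆ Sym2 V` (`ω ∩ E` red, `ωᶜ ∩ E` blue), source `s`, red / blue edge clusters
`C_s(ω ∩ E)`, `C_s(ωᶜ ∩ E)` (BHK's open edge clusters), `Δ(ω) = (F(red) − F(blue))(G(red) − G(blue))` for increasing `F, G`;
`BIC_E(R) = Σ_{ω : no r ∈ R joined to s in both colours} Δ(ω)`;  `T_E(R,X)` = the same sum restricted further to "no `x ∈ X` joined to `s`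
in either colour" (`Peel.tsum`); `SC(E,X) = T_E(∅,X)` is the antithetic / coefficientwise BHK sum of MEMO-gen29 §3.  CONJECTURE BIC (gen 31):
`BIC_E(R) ≥ 0` for every finite `E`, `s`, `R`; it implies `T_E(R,X) ≥ 0` and `SC(E,X) ≥ 0` by peeling (`Peel.tsum_nonneg_of_bic`, gen 36).

THE CLASS: "cones with clique-apexes" — every vertex `x ≠ s` not adjacent to `s` has all its `E`-neighbours adjacent to `s` (`hN`) and pairwise
adjacent (`hK`).  It contains every cone (THEOREM I, `s` adjacent to all), every `K₄ − e` seen from a degree-two vertex (the smallest instances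
left open by Theorems D, F, H, I in the coverage census of MEMO-gen36 §4e), and THEOREM J's configurations.
* `Antithetic.keyCone_bic_nonneg` — THEOREM K in KEY FORM: `BIC_E(R) ≥ 0` for every `R` whenever `(E, s)` has the KEY PROPERTY "for every
  colouring, every vertex reached in neither colour has a monochromatic star" (the only way the class enters the zone-system proofs).
* `Antithetic.apexCone_bic_nonneg` — THEOREM K: on the class, `BIC_E(R) ≥ 0` for EVERY `R` (CONJECTURE K of MEMO-gen36 §4f; the class has
  the key property by THEOREM J's key fact).
* `Antithetic.apexCone_tsum_nonneg` — on the class, `T_E(R,X) ≥ 0` for every `R ∌ s` and every sink set `X` (the class is closed under deleting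
  the edges at a vertex; peeling meta-theorem `Peel.tsum_nonneg_of_bic_family`).
* `Antithetic.apexCone_sc_nonneg` — on the class, the antithetic BHK inequality with sinks `SC(E,X) ≥ 0` for every `X`.
PROOF of THEOREM K: the zone-system theorem `Antithetic.zoneSystem_bic_nonneg` (…AntitheticZoneSystem) applied to the zone system of
`…AntitheticApexConeZones` (rule v3 of MEMO-gen37: reached `r` ↦ its cluster of the non-reaching colour; unreached `r` ↦ `{r}`, or the zone of
its swallower), whose hypotheses are `ACone.mem_zone_self`, `ACone.source_not_mem_zone`, `ACone.boundary_key`, `ACone.consistent`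
(…ApexConeConsistency) and `ACone.invariance` (…ApexConeInvarianceTwo).  Machine census of the rule with the canonical top: HOME/code/gen37/
lab37/zonerule3.py, 0 failures on all 4 604 `(G, s, R)` with `n ≤ 5`; kit j157250 at `n = 6`.
[cite: VandenbergHaggstromKahn2005, §1 p. 6 ("Harris' inequality"), §1 p. 3 (open cluster `C_s`)]
-/

noncomputable section

namespace Summit.CriticalPhenomena.PercolationContinuityZ3.Theorems

open Literature.Probability.Percolation
open scoped Classical symmDiff

namespace Antithetic

section TheoremK

variable {V : Type*} [Fintype V]

/-- **THEOREM K, key form (prim-hp-2 gen 37).**  `E` an edge set on a finite vertex type and `s` a source with the KEY PROPERTY: for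
every colouring `T`, every vertex joined to `s` neither in `T ∩ E` nor in `Tᶜ ∩ E` has all its non-loop `E`-edges in `T` or all outside `T`.
Then for EVERY vertex set `R` and all increasing `F, G` of the edge cluster,
`0 ≤ Σ_{ω : no r ∈ R is joined to s both in ω ∩ E and in ωᶜ ∩ E} (F(C_s(ω∩E)) − F(C_s(ωᶜ∩E))) · (G(C_s(ω∩E)) − G(C_s(ωᶜ∩E)))`.
Proof: the zone-system theorem with the rule-v3 zone system (module docstring). [this work] -/
theorem keyCone_bic_nonneg (E : Set (Sym2 V)) (s : V)
    (hkey : ∀ (T : Set (Sym2 V)) (x : V), ¬ (openGraph (T ∩ E)).Reachable s x → ¬ (openGraph (Tᶜ ∩ E)).Reachable s x →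
      (∀ u, s(x, u) ∈ E → u ≠ x → s(x, u) ∈ T) ∨ (∀ u, s(x, u) ∈ E → u ≠ x → s(x, u) ∉ T))
    (R : Set V) {F G : Set (Sym2 V) → ℝ} (hF : Monotone F) (hG : Monotone G) :
    0 ≤ ∑ ω ∈ Finset.univ.filter (fun ω : Set (Sym2 V) =>
        ∀ r ∈ R, ¬ ((openGraph (ω ∩ E)).Reachable s r ∧ (openGraph (ωᶜ ∩ E)).Reachable s r)),
      (F (openEdgeCluster (ω ∩ E) s) - F (openEdgeCluster (ωᶜ ∩ E) s)) *
        (G (openEdgeCluster (ω ∩ E) s) - G (openEdgeCluster (ωᶜ ∩ E) s)) :=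
  zoneSystem_bic_nonneg E s R (fun T r => ACone.zone E s R T r) (fun T r => r ∈ ACone.beta E s R T)
    (fun _ _ _ _ => ACone.mem_zone_self) (fun _ hT u hu => ACone.source_not_mem_zone (hT u hu))
    (fun _ hT u hu _ hx _ hy hxy => ACone.boundary_key hkey (hT u hu) hx hy hxy)
    (fun _ hT _ hu _ hv e heu hev => ACone.consistent hkey hT hu hv (e := e) heu hev)
    (fun _ hT _ hM hag => ACone.invariance hkey hT hM hag) hF hG

/-- **THEOREM K (prim-hp-2 gen 37): BIC on cones with clique-apexes, every avoidance set** (CONJECTURE K of MEMO-gen36 §4f).  `E` an edge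
set on a finite vertex type and `s` a source such that every vertex `x ≠ s` with `sx ∉ E` has all its `E`-neighbours adjacent to `s` and
pairwise adjacent; `R` ANY vertex set; `F, G` increasing in the edge cluster.  Then
`0 ≤ Σ_{ω : no r ∈ R is joined to s both in ω ∩ E and in ωᶜ ∩ E} (F(C_s(ω∩E)) − F(C_s(ωᶜ∩E))) · (G(C_s(ω∩E)) − G(C_s(ωᶜ∩E)))`.
(Contains THEOREM I — cones — and THEOREM J's class.)  The class has the key property by THEOREM J's key fact
`ACone.mono_of_unreached`. [this work] -/
theorem apexCone_bic_nonneg (E : Set (Sym2 V)) (s : V)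
    (hN : ∀ x u, x ≠ s → s(s, x) ∉ E → s(x, u) ∈ E → u ≠ x → s(s, u) ∈ E)
    (hK : ∀ x u v, x ≠ s → s(s, x) ∉ E → s(x, u) ∈ E → s(x, v) ∈ E → u ≠ x → v ≠ x → u ≠ v → s(u, v) ∈ E)
    (R : Set V) {F G : Set (Sym2 V) → ℝ} (hF : Monotone F) (hG : Monotone G) :
    0 ≤ ∑ ω ∈ Finset.univ.filter (fun ω : Set (Sym2 V) =>
        ∀ r ∈ R, ¬ ((openGraph (ω ∩ E)).Reachable s r ∧ (openGraph (ωᶜ ∩ E)).Reachable s r)),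
      (F (openEdgeCluster (ω ∩ E) s) - F (openEdgeCluster (ωᶜ ∩ E) s)) *
        (G (openEdgeCluster (ω ∩ E) s) - G (openEdgeCluster (ωᶜ ∩ E) s)) :=
  keyCone_bic_nonneg E s (fun _ _ hr hb => ACone.mono_of_unreached hN hK hr hb) R hF hG

omit [Fintype V] in
/-- The class "cones with clique-apexes" is closed under deleting all pairs at a vertex `y ≠ s`. [this work] -/
theorem apexCone_peel (E : Set (Sym2 V)) (s : V)
    (hN : ∀ x u, x ≠ s → s(s, x) ∉ E → s(x, u) ∈ E → u ≠ x → s(s, u) ∈ E)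
    (hK : ∀ x u v, x ≠ s → s(s, x) ∉ E → s(x, u) ∈ E → s(x, v) ∈ E → u ≠ x → v ≠ x → u ≠ v → s(u, v) ∈ E)
    (y : V) (hys : y ≠ s) :
    (∀ x u, x ≠ s → s(s, x) ∉ E \ {e | y ∈ e} → s(x, u) ∈ E \ {e | y ∈ e} → u ≠ x → s(s, u) ∈ E \ {e | y ∈ e}) ∧
      (∀ x u v, x ≠ s → s(s, x) ∉ E \ {e | y ∈ e} → s(x, u) ∈ E \ {e | y ∈ e} → s(x, v) ∈ E \ {e | y ∈ e} → u ≠ x → v ≠ x →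
        u ≠ v → s(u, v) ∈ E \ {e | y ∈ e}) := by
  -- if `sx` was deleted then `y = x`, contradicting an undeleted edge at `x`
  have key : ∀ x u, s(s, x) ∉ E \ {e | y ∈ e} → s(x, u) ∈ E \ {e | y ∈ e} → s(s, x) ∉ E := by
    intro x u hsx hxu h
    apply hsx
    refine ⟨h, fun hy => ?_⟩
    rcases Sym2.mem_iff.1 hy with rfl | rfl
    · exact hys rfl
    · exact hxu.2 (Sym2.mem_mk_left _ _)
  refine ⟨fun x u hxs hsx hxu hux => ⟨hN x u hxs (key x u hsx hxu) hxu.1 hux, fun hy => ?_⟩,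
    fun x u v hxs hsx hxu hxv hux hvx huv => ⟨hK x u v hxs (key x u hsx hxu) hxu.1 hxv.1 hux hvx huv, fun hy => ?_⟩⟩
  · rcases Sym2.mem_iff.1 hy with rfl | rfl
    · exact hys rfl
    · exact hxu.2 (Sym2.mem_mk_right _ _)
  · rcases Sym2.mem_iff.1 hy with rfl | rfl
    · exact hxu.2 (Sym2.mem_mk_right _ _)
    · exact hxv.2 (Sym2.mem_mk_right _ _)

/-- **`T_E(R,X) ≥ 0` on cones with clique-apexes** (every `R ∌ s`, every sink set `X`): the class is peeling-closed (`apexCone_peel`) and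
BIC holds on it (`apexCone_bic_nonneg`), so the peeling meta-theorem `Peel.tsum_nonneg_of_bic_family` applies. [this work] -/
theorem apexCone_tsum_nonneg (F G : Set (Sym2 V) → ℝ) (hF : Monotone F) (hG : Monotone G) (E : Set (Sym2 V)) (s : V)
    (hN : ∀ x u, x ≠ s → s(s, x) ∉ E → s(x, u) ∈ E → u ≠ x → s(s, u) ∈ E)
    (hK : ∀ x u v, x ≠ s → s(s, x) ∉ E → s(x, u) ∈ E → s(x, v) ∈ E → u ≠ x → v ≠ x → u ≠ v → s(u, v) ∈ E)
    (R X : Set V) (hRs : s ∉ R) : 0 ≤ Peel.tsum F G E s R X := by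
  let P : Set (Sym2 V) → Prop := fun E' =>
    (∀ x u, x ≠ s → s(s, x) ∉ E' → s(x, u) ∈ E' → u ≠ x → s(s, u) ∈ E') ∧
      (∀ x u v, x ≠ s → s(s, x) ∉ E' → s(x, u) ∈ E' → s(x, v) ∈ E' → u ≠ x → v ≠ x → u ≠ v → s(u, v) ∈ E')
  have hPeel : ∀ E', P E' → ∀ y, y ≠ s → P (E' \ {e | y ∈ e}) := fun E' hE' y hys => apexCone_peel E' s hE'.1 hE'.2 y hys
  refine Peel.tsum_nonneg_of_bic_family F G s P hPeel ?_ E ⟨hN, hK⟩ R X hRs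
  intro E' hE' R' _
  have h := apexCone_bic_nonneg E' s hE'.1 hE'.2 R' hF hG
  have hset : Peel.tset E' s R' ∅ = Finset.univ.filter (fun ω : Set (Sym2 V) =>
      ∀ r ∈ R', ¬ ((openGraph (ω ∩ E')).Reachable s r ∧ (openGraph (ωᶜ ∩ E')).Reachable s r)) := by
    ext ω
    simp [Peel.mem_tset]
  unfold Peel.tsum Peel.delta
  rw [hset]
  exact h

/-- **The antithetic BHK inequality with sinks on cones with clique-apexes**: for every sink set `X`,
`0 ≤ Σ_{ω : no x ∈ X joined to s in ω∩E or ωᶜ∩E} (F(C_s(ω∩E)) − F(C_s(ωᶜ∩E)))(G(C_s(ω∩E)) − G(C_s(ωᶜ∩E)))`, i.e. `SC(E,X) ≥ 0`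
(MEMO-gen31 §1: the 2-copy shadow of coefficientwise BHK, here for the whole class and every `X`). [this work] -/
theorem apexCone_sc_nonneg (F G : Set (Sym2 V) → ℝ) (hF : Monotone F) (hG : Monotone G) (E : Set (Sym2 V)) (s : V)
    (hN : ∀ x u, x ≠ s → s(s, x) ∉ E → s(x, u) ∈ E → u ≠ x → s(s, u) ∈ E)
    (hK : ∀ x u v, x ≠ s → s(s, x) ∉ E → s(x, u) ∈ E → s(x, v) ∈ E → u ≠ x → v ≠ x → u ≠ v → s(u, v) ∈ E) (X : Set V) :
    0 ≤ ∑ ω ∈ Finset.univ.filter (fun ω : Set (Sym2 V) =>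
        ∀ x ∈ X, ¬ (openGraph (ω ∩ E)).Reachable s x ∧ ¬ (openGraph (ωᶜ ∩ E)).Reachable s x),
      (F (openEdgeCluster (ω ∩ E) s) - F (openEdgeCluster (ωᶜ ∩ E) s)) *
        (G (openEdgeCluster (ω ∩ E) s) - G (openEdgeCluster (ωᶜ ∩ E) s)) := by
  have h := apexCone_tsum_nonneg F G hF hG E s hN hK ∅ X (Set.notMem_empty s)
  have hset : Peel.tset E s ∅ X = Finset.univ.filter (fun ω : Set (Sym2 V) =>
      ∀ x ∈ X, ¬ (openGraph (ω ∩ E)).Reachable s x ∧ ¬ (openGraph (ωᶜ ∩ E)).Reachable s x) := by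
    ext ω
    simp [Peel.mem_tset]
  unfold Peel.tsum at h
  rw [hset] at h
  exact h

/-- **THEOREM I recovered from THEOREM K**: on a cone (`s` adjacent to every other vertex) the class hypotheses are vacuous, so
`T_E(R,X) ≥ 0` for every `R ∌ s` and every `X` — THEOREM I together with sinks (new: gen 36 had sinks only for hanging trees behind
bridges). [this work] -/
theorem cone_tsum_nonneg (F G : Set (Sym2 V) → ℝ) (hF : Monotone F) (hG : Monotone G) (E : Set (Sym2 V)) (s : V)
    (hcone : ∀ v, v ≠ s → s(s, v) ∈ E) (R X : Set V) (hRs : s ∉ R) : 0 ≤ Peel.tsum F G E s R X :=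
  apexCone_tsum_nonneg F G hF hG E s (fun x _ hxs hsx _ _ => absurd (hcone x hxs) hsx)
    (fun x _ _ hxs hsx _ _ _ _ _ => absurd (hcone x hxs) hsx) R X hRs

end TheoremK

end Antithetic

end Summit.CriticalPhenomena.PercolationContinuityZ3.Theorems
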